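import Literature.MathematicalPhysics.QuantumManyBody.BoseGasFreeDirichletBEC
import Literature.MathematicalPhysics.QuantumManyBody.BoseGasSubcellCondensationDilute
import Summits.AtomisticToContinuum.BoseEinsteinCondensation.Theses.CondensateScaleLadder

/-!
# `CondensateScaleLadder` · R1 `HealingScaleCondensate` (stmt-AtomisticToContinuum-26085) PROVED

decomp-a2c prover hand-1 (generation 18), from the cell writer's kernel derivation (writer-1 g2, `R1FromFloor.lean`, evidence on the item):
healing-scale local condensation of dilute repulsive finite-range Bose gases follows from the in-tree SUB-CELL FLOOR theorems
`Literature.MathematicalPhysics.QuantumManyBody.BoseGas.floor_of_scatteringLength_zero` / `…floor_of_scatteringLength_pos`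
(`BoseGasSubcellCondensationDilute`, both proved; merged over the dichotomy `scatteringLength v = 0 ∨ 0 < scatteringLength v`) by a
dyadic scale selection and a pigeonhole over the `8^k` sub-cells: constants `M = 1`, `ℓ = 2/√ρ`, `c = 7/64`, `δ = 1`; the local mode is the
sub-cell constant mode `subMode (L/2^k) q` at the dyadic scale `L/2^k ∈ [1/√ρ, 2/√ρ)` carrying the largest occupation.
`healingScaleCondensate_proof : HealingScaleCondensate` — the ROUTE DECL of item 26085, by name.  No definitions, no `sorry`, standard axioms.
`--workitem stmt-AtomisticToContinuum-26085`.
-/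

noncomputable section

namespace Summit.AtomisticToContinuum.BoseEinsteinCondensation.Theses.CondensateScaleLadder

open scoped BigOperators Topology ENNReal NNReal ComplexConjugate
open Filter Set MeasureTheory
open Literature.MathematicalPhysics.QuantumManyBody.BoseGas


namespace R1

/-- A sub-cell constant mode of side `s ≤ ℓ` is a local mode of side `≤ ℓ` in the sense of the route items. -/
theorem subMode_isLocalMode {k : ℕ} {s ℓ : ℝ} (hs : 0 < s) (hsℓ : s ≤ ℓ) (q : SubIdx k) :
    MeasureTheory.AEStronglyMeasurable (subMode s q) MeasureTheory.volume ∧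
      (∫⁻ x, (‖subMode s q x‖₊ : ENNReal) ^ 2) = 1 ∧
      ∃ (a : EuclideanSpace ℝ (Fin 3)) (s' : ℝ), 0 < s' ∧ s' ≤ ℓ ∧
        ∀ x : EuclideanSpace ℝ (Fin 3), (∃ i : Fin 3, x i < a i ∨ a i + s' ≤ x i) → subMode s q x = 0 := by
  refine ⟨aestronglyMeasurable_subMode s q, lintegral_subMode_sq hs q, subOffset s q, s, hs, hsℓ, ?_⟩
  intro x hx
  have hxQ : x ∉ subCell s q := by
    rw [mem_subCell]
    obtain ⟨i, hi⟩ := hx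
    intro h
    obtain ⟨h1, h2⟩ := h i
    rw [subOffset_apply] at hi
    rcases hi with hi | hi <;> linarith
  rw [subMode_eq_indicator, Set.indicator_of_notMem hxQ]

/-- Dyadic scale selection: if `L√ρ ≥ 1` there is `k` with `L/2^k ∈ [1/√ρ, 2/√ρ)`. -/
theorem exists_dyadic_scale {L r : ℝ} (hr : 0 < r) (h : 1 ≤ L * r) :
    ∃ k : ℕ, (2 : ℝ) ^ k ≤ L * r ∧ L * r < 2 ^ (k + 1) ∧
      1 / r ≤ L / 2 ^ k ∧ L / 2 ^ k < 2 * (1 / r) := by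
  obtain ⟨k, hk1, hk2⟩ := exists_nat_pow_near h one_lt_two
  have h2k : (0 : ℝ) < 2 ^ k := by positivity
  refine ⟨k, hk1, hk2, ?_, ?_⟩
  · rw [div_le_div_iff₀ hr h2k, one_mul]
    linarith
  · rw [pow_succ] at hk2
    rw [div_lt_iff₀ h2k, show 2 * (1 / r) * 2 ^ k = 2 ^ k * 2 / r by ring, lt_div_iff₀ hr]
    linarith

end R1

open R1 in
/-- **R1 from the floor** (kernel): the common conclusion of the two floor theorems (verbatim, `∀ M > 0`) implies
`HealingScaleCondensate` (the route decl of item 26085). [writer-1 g2 derivation; this file] -/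
theorem healingScaleCondensate_of_floor
    (hF : ∀ v : ℝ → ℝ≥0∞, IsRepulsiveFiniteRange v → ∀ M : ℝ, 0 < M →
      ∃ ρ₀ : ℝ, 0 < ρ₀ ∧ ∀ ρ : ℝ, 0 < ρ → ρ < ρ₀ →
        ∀ᶠ N : ℕ in atTop, ∀ Ψ : TrialState N (sideLength ρ N),
          energy v Ψ ≤ groundStateEnergy v N (sideLength ρ N) + 1 →
          ∀ k : ℕ, M / Real.sqrt ρ ≤ sideLength ρ N / 2 ^ k →
            sideLength ρ N / 2 ^ k < 2 * (M / Real.sqrt ρ) →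
              ENNReal.ofReal (7 * (N : ℝ) / 8) ≤
                ∑ q : SubIdx (2 ^ k), occupation N (subMode (sideLength ρ N / 2 ^ k) q) Ψ.ψ) :
    HealingScaleCondensate := by
  intro v hv
  obtain ⟨ρ₀, hρ₀, H⟩ := hF v hv 1 one_pos
  refine ⟨ρ₀, hρ₀, fun ρ hρ hρlt => ?_⟩
  set r : ℝ := Real.sqrt ρ with hr_def
  have hr : 0 < r := Real.sqrt_pos.2 hρ
  have hr2 : r ^ 2 = ρ := Real.sq_sqrt hρ.le
  refine ⟨2 / r, by positivity, 7 / 64, by norm_num, ?_⟩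
  have hev := H ρ hρ hρlt
  have hL : ∀ᶠ N : ℕ in atTop, 1 ≤ sideLength ρ N * r :=
    ((Literature.MathematicalPhysics.QuantumManyBody.BoseGas.tendsto_sideLength_atTop hρ).atTop_mul_const
      hr).eventually_ge_atTop 1
  filter_upwards [hev, hL] with N hN hLN
  have hL3 : sideLength ρ N ^ 3 * ρ = N := by
    rw [Literature.MathematicalPhysics.QuantumManyBody.BoseGas.sideLength_pow_three hρ N]; field_simp
  set L : ℝ := sideLength ρ N with hL_def
  obtain ⟨k, hk1, -, hs1, hs2⟩ := exists_dyadic_scale hr hLN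
  have h2k : (0 : ℝ) < 2 ^ k := by positivity
  set s : ℝ := L / 2 ^ k with hs_def
  have hs : 0 < s := lt_of_lt_of_le (by positivity) hs1
  have hsℓ : s ≤ 2 / r := hs2.le.trans_eq (by ring)
  refine ⟨1, one_pos, fun Ψ hΨ => ?_⟩
  -- the floor at scale s, and the best sub-cell
  have h78 : ENNReal.ofReal (7 * (N : ℝ) / 8) ≤
      ∑ q : SubIdx (2 ^ k), occupation N (subMode s q) Ψ.ψ := hN Ψ hΨ k hs1 hs2
  haveI : Nonempty (SubIdx (2 ^ k)) := ⟨fun _ => ⟨0, pow_pos two_pos k⟩⟩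
  obtain ⟨q, hq⟩ := exists_sum_le_card_mul fun q : SubIdx (2 ^ k) => occupation N (subMode s q) Ψ.ψ
  have hcard : (Fintype.card (SubIdx (2 ^ k)) : ℝ≥0∞) = ENNReal.ofReal (((2 : ℝ) ^ k) ^ 3) := by
    rw [← ENNReal.ofReal_natCast]
    congr 1
    simp [SubIdx, Fintype.card_fin]
  refine ⟨subMode s q, subMode_isLocalMode hs hsℓ q, ?_⟩
  -- the threshold: (7/64) ρ (2/r)³ · 8^k ≤ 7N/8
  have h1 : ((2 : ℝ) ^ k) ^ 3 ≤ L ^ 3 * r ^ 3 := by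
    rw [← mul_pow]; exact pow_le_pow_left₀ h2k.le hk1 3
  have h3 : ρ * ((2 : ℝ) ^ k) ^ 3 ≤ N * r ^ 3 := by
    calc ρ * ((2 : ℝ) ^ k) ^ 3 ≤ ρ * (L ^ 3 * r ^ 3) := mul_le_mul_of_nonneg_left h1 hρ.le
      _ = (L ^ 3 * ρ) * r ^ 3 := by ring
      _ = N * r ^ 3 := by rw [hL3]
  have hreal : 7 / 64 * ρ * (2 / r) ^ 3 * ((2 : ℝ) ^ k) ^ 3 ≤ 7 * (N : ℝ) / 8 := by
    rw [div_pow, show (7 : ℝ) / 64 * ρ * (2 ^ 3 / r ^ 3) * ((2 : ℝ) ^ k) ^ 3 =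
      (7 / 8) * (ρ * ((2 : ℝ) ^ k) ^ 3) / r ^ 3 by ring, div_le_iff₀ (by positivity)]
    nlinarith [h3]
  have hpos : (0 : ℝ) ≤ 7 / 64 * ρ * (2 / r) ^ 3 := by positivity
  -- in ℝ≥0∞: card · ofReal(c ρ ℓ³) ≤ ofReal(7N/8) ≤ ∑ ≤ card · occ q
  have hkey : (Fintype.card (SubIdx (2 ^ k)) : ℝ≥0∞) * ENNReal.ofReal (7 / 64 * ρ * (2 / r) ^ 3) ≤
      (Fintype.card (SubIdx (2 ^ k)) : ℝ≥0∞) * occupation N (subMode s q) Ψ.ψ := by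
    refine le_trans ?_ (h78.trans hq)
    rw [hcard, ← ENNReal.ofReal_mul (by positivity), mul_comm]
    exact ENNReal.ofReal_le_ofReal hreal
  have hc0 : (Fintype.card (SubIdx (2 ^ k)) : ℝ≥0∞) ≠ 0 := by
    rw [hcard]; exact (ENNReal.ofReal_pos.2 (by positivity)).ne'
  have hctop : (Fintype.card (SubIdx (2 ^ k)) : ℝ≥0∞) ≠ ⊤ := ENNReal.natCast_ne_top _
  exact (ENNReal.mul_le_mul_iff_right hc0 hctop).1 hkey

/-- ★ **R1 `HealingScaleCondensate` PROVED (item stmt-AtomisticToContinuum-26085, the route decl by name):** the floor hypothesis is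
discharged by the in-tree theorems `floor_of_scatteringLength_zero` / `floor_of_scatteringLength_pos` over the dichotomy on the scattering length.
[this file] -/
theorem healingScaleCondensate_proof : HealingScaleCondensate :=
  healingScaleCondensate_of_floor fun v hv _ hM =>
    (eq_zero_or_pos (scatteringLength v)).elim (fun h0 => floor_of_scatteringLength_zero hv h0 hM)
      (fun hp => floor_of_scatteringLength_pos hv hp hM)

end Summit.AtomisticToContinuum.BoseEinsteinCondensation.Theses.CondensateScaleLadder
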